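import Literature.NumberTheory.Automorphic.ChevalleyVermaWeights
import HarnessLib

/-!
# The irreducible highest weight module `L(λ) = M(λ) / N(λ)` of a Chevalley system

Trunk T-AUTOMORPHIC (G25 AutomorphicL); highest-weight theory for Chevalley's existence theorem
(`Literature.NumberTheory.Automorphic.chevalley_existence`, Springer 10.1.1), step 3 after
`ChevalleyVermaWeights.lean` (maximal submodule `maxSub S lam` of the Verma module
`Verma S lam`, weight spaces `wsp S lam x` by `X`-degree `x`):

* `Irr S lam = Verma S lam ⧸ maxSub S lam`, a `U(L)`-module and Lie module over `k`
  (`⁅x, v⁆ = ι(x) • v`), with the quotient map `mkL` and highest weight vector `hwvL ≠ 0`;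
* **irreducibility**: every `U(L)`-submodule is `⊥` or `⊤` (`eq_bot_or_eq_top`), and so is every
  `k`-subspace stable under `L` (`eq_bot_or_eq_top_of_forall_lie_mem`; a `k`-subspace stable
  under `ι(L)` is `U(L)`-stable, `smul_mem_of_forall_ι_smul_mem`, by the PBW words);
* the weight spaces `wspL S lam x` (images of the `wsp`): `h_s` acts by `λ_s + ⟨x, α_s^∨⟩`,
  `e_α` maps `L(λ)_x` into `L(λ)_{x+α}`, they span `L(λ)` (`iSup_wspL_eq_top`), are
  **finite-dimensional** (`finiteDimensional_wspL`: finitely many multi-indices of a given degree,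
  `finite_rootSum_eq`, through `⟨·, 2ρ^∨⟩`) and **independent** (`iSupIndep_wspL`, through the
  general fact that simultaneous eigenvectors with distinct characters are independent,
  `DiagSep.eq_zero_of_sum_eigen_eq_zero`).

Everything is proved; statements are [folklore] (Humphreys, *Introduction to Lie Algebras*,
§20.2–§20.3). Mathlib has no highest weight modules; nothing here duplicates Mathlib or the tree
(`lean search`).
-/

noncomputable section

open Set Function Finsupp UniversalEnvelopingAlgebra
open Literature.Algebra.Lie.PBW

attribute [local instance 100] LieRing.ofAssociativeRing

namespace Literature.NumberTheory.Automorphic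

/-! ### Simultaneous eigenvectors with distinct characters are independent -/

namespace DiagSep

variable {k : Type*} [Field k] {M : Type*} [AddCommGroup M] [Module k M]

/-- **Simultaneous eigenvectors with pairwise distinct characters are linearly independent**:
if `T s (v x) = c x s • v x` for all `s` and the characters `c x` are pairwise distinct on the
finite set `F`, then `∑_{x ∈ F} v x = 0` forces `v x = 0` for all `x ∈ F` (apply
`∏_{y ≠ x₀} (T_{s_y} - c y s_y)`). [folklore] -/
theorem eq_zero_of_sum_eigen_eq_zero {σ Λ : Type*} (T : σ → M →ₗ[k] M) (F : Finset Λ)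
    (c : Λ → σ → k) (v : Λ → M) (hv : ∀ x ∈ F, ∀ s, T s (v x) = c x s • v x)
    (hsep : ∀ x ∈ F, ∀ y ∈ F, x ≠ y → ∃ s, c x s ≠ c y s) (h0 : ∑ x ∈ F, v x = 0) :
    ∀ x ∈ F, v x = 0 := by
  classical
  intro x₀ hx₀
  -- separating indices
  have hFsep : ∀ y ∈ F.erase x₀, ∃ s, c x₀ s ≠ c y s := fun y hy =>
    hsep x₀ hx₀ y (Finset.mem_of_mem_erase hy) (Finset.ne_of_mem_erase hy).symm
  by_cases hFe : F.erase x₀ = ∅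
  · -- `F = {x₀}`
    have hF : F = {x₀} := by
      ext y
      constructor
      · intro hy
        by_contra hne
        have : y ∈ F.erase x₀ := Finset.mem_erase.2 ⟨fun h => hne (by simp [h]), hy⟩
        rw [hFe] at this
        exact absurd this (Finset.notMem_empty _)
      · intro hy
        rw [Finset.mem_singleton.1 hy]
        exact hx₀
    rw [hF, Finset.sum_singleton] at h0
    exact h0
  obtain ⟨y₁, hy₁⟩ := Finset.nonempty_iff_ne_empty.2 hFe
  obtain ⟨s₁, -⟩ := hFsep y₁ hy₁
  haveI : Nonempty σ := ⟨s₁⟩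
  choose! sep hsepF using hFsep
  -- the product operator and its action on the eigenvectors
  have hprod : ∀ (L : List Λ) (x : Λ), x ∈ F →
      (L.map fun y => T (sep y) - algebraMap k (M →ₗ[k] M) (c y (sep y))).prod (v x) =
        (L.map fun y => c x (sep y) - c y (sep y)).prod • v x := by
    intro L x hx
    induction L with
    | nil => simp
    | cons y L ih =>
      rw [List.map_cons, List.prod_cons, Module.End.mul_apply, ih, map_smul, LinearMap.sub_apply,
        hv x hx, Module.algebraMap_end_apply, ← sub_smul, smul_smul, List.map_cons, List.prod_cons,
        mul_comm]
  set l := (F.erase x₀).toList with hl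
  have hkill : ∀ x ∈ F.erase x₀, (l.map fun y => c x (sep y) - c y (sep y)).prod = 0 := by
    intro x hx
    apply List.prod_eq_zero
    exact List.mem_map.2 ⟨x, Finset.mem_toList.2 hx, sub_self _⟩
  have hkeep : (l.map fun y => c x₀ (sep y) - c y (sep y)).prod ≠ 0 := by
    apply List.prod_ne_zero
    intro hmem
    obtain ⟨y, hy, hy0⟩ := List.mem_map.1 hmem
    exact hsepF y (Finset.mem_toList.1 hy) (sub_eq_zero.1 hy0)
  -- apply the product operator to the relation
  have h1 := congrArg ((l.map fun y => T (sep y) - algebraMap k (M →ₗ[k] M) (c y (sep y))).prod) h0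
  rw [map_sum, map_zero, ← Finset.add_sum_erase _ _ hx₀, hprod l x₀ hx₀,
    Finset.sum_eq_zero (fun x hx => by
      rw [hprod l x (Finset.mem_of_mem_erase hx), hkill x hx, zero_smul]), add_zero] at h1
  exact (smul_eq_zero.1 h1).resolve_left hkeep

end DiagSep

namespace ChevalleyVerma

variable {k : Type*} [Field k]
variable {ι X Y : Type*} [AddCommGroup X] [AddCommGroup Y] [Fintype ι] [DecidableEq ι]
variable {P : RootPairing ι ℤ X Y} {b : P.Base}

/-! ### Finiteness of the fibres of `rootSum` (Kostant) -/

/-- **Finitely many multi-indices on the negative roots have a given `X`-degree**: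
`⟨rootSum n, 2ρ^∨⟩ = 2 ∑ n_β ht(β) ≤ -2 ∑ n_β`. [folklore] -/
theorem finite_rootSum_eq [P.IsReduced] (x : X) : {n : NegRoot b →₀ ℕ | rootSum b n = x}.Finite := by
  classical
  set N : ℤ := -(P.toLinearMap x b.twoRhoCoroot) with hN
  -- every coordinate of such an `n` is bounded by `N`
  have hbd : ∀ n : NegRoot b →₀ ℕ, rootSum b n = x → ∀ i, (n i : ℤ) ≤ N := by
    intro n hn i
    have hsum : P.toLinearMap (rootSum b n) b.twoRhoCoroot = ∑ j ∈ n.support, (n j : ℤ) * (2 * b.height j.1) := by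
      unfold rootSum Finsupp.sum
      rw [map_sum, LinearMap.sum_apply]
      refine Finset.sum_congr rfl fun j _ => ?_
      dsimp only
      rw [map_nsmul, LinearMap.smul_apply, nsmul_eq_mul]
      exact congrArg _ (b.root'_twoRhoCoroot j.1)
    have hle : ∀ j ∈ n.support, (n j : ℤ) * (2 * b.height j.1) ≤ -2 * (n j : ℤ) := by
      intro j _
      have h1 : ¬ 0 < b.height j.1 := j.2
      have h2 := b.height_ne_zero j.1
      have h3 : b.height j.1 ≤ -1 := by omega
      have h4 : (0 : ℤ) ≤ n j := Nat.cast_nonneg _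
      have h5 : (n j : ℤ) * b.height j.1 ≤ (n j : ℤ) * (-1) := mul_le_mul_of_nonneg_left h3 h4
      linarith
    have hT : ∑ j ∈ n.support, 2 * (n j : ℤ) ≤ N := by
      have h1 : P.toLinearMap (rootSum b n) b.twoRhoCoroot ≤ -∑ j ∈ n.support, 2 * (n j : ℤ) := by
        rw [hsum, ← Finset.sum_neg_distrib]
        exact Finset.sum_le_sum fun j hj => by have := hle j hj; linarith
      rw [hn] at h1
      rw [hN]
      linarith
    have hT0 : 0 ≤ ∑ j ∈ n.support, 2 * (n j : ℤ) := Finset.sum_nonneg fun j _ => by positivity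
    by_cases hi : i ∈ n.support
    · have h1 := Finset.single_le_sum (f := fun j => 2 * (n j : ℤ)) (fun j _ => by positivity) hi
      have h0 : (0 : ℤ) ≤ n i := Nat.cast_nonneg _
      linarith
    · rw [Finsupp.notMem_support_iff.1 hi, Nat.cast_zero]
      linarith
  have hfin : {n : NegRoot b → ℕ | ∀ i, n i ∈ Set.Iic N.toNat}.Finite := Set.Finite.pi' fun _ => Set.finite_Iic _
  refine (hfin.image fun f => Finsupp.equivFunOnFinite.symm f).subset ?_
  intro n hn
  refine ⟨fun i => n i, fun i => ?_, by ext i; simp⟩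
  have := hbd n hn i
  simp only [Set.mem_Iic]
  omega

/-- The multi-indices of a given degree, as a finset. [folklore] -/
def rootSumFiber [P.IsReduced] (x : X) : Finset (NegRoot b →₀ ℕ) := (finite_rootSum_eq (b := b) x).toFinset

/-- Membership in `rootSumFiber`. [folklore] -/
@[simp] lemma mem_rootSumFiber [P.IsReduced] (x : X) (n : NegRoot b →₀ ℕ) :
    n ∈ rootSumFiber (b := b) x ↔ rootSum b n = x := by
  rw [rootSumFiber, Set.Finite.mem_toFinset, Set.mem_setOf_eq]

section System

variable {L : Type*} [LieRing L] [LieAlgebra k L] {h : b.support → L} {e : ι → L}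
  (S : IsChevalleySystem P b k h e)

local notation "𝓤" => UniversalEnvelopingAlgebra k L
local notation "ιU" => UniversalEnvelopingAlgebra.ι k (L := L)

include S

/-! ### `U(L)`-stability from `L`-stability -/

omit [Fintype ι] [DecidableEq ι] in
/-- **A `k`-subspace of a `U(L)`-module stable under `ι(L)` is stable under `U(L)`** (the words
in a basis of `L` span `U(L)`, `Literature.Algebra.Lie.PBW.span_word_eq_top`). [folklore] -/
theorem smul_mem_of_forall_ι_smul_mem {M : Type*} [AddCommGroup M] [Module 𝓤 M] [Module k M]
    [IsScalarTower k 𝓤 M] (W : Submodule k M) (hW : ∀ (x : L), ∀ v ∈ W, ιU x • v ∈ W)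
    (u : 𝓤) {v : M} (hv : v ∈ W) : u • v ∈ W := by
  have hword : ∀ l : List (b.support ⊕ ι), word S.basis l • v ∈ W := by
    intro l
    induction l with
    | nil => simpa using hv
    | cons x l ih =>
      rw [word_cons, mul_smul]
      exact hW _ _ ih
  have hu : u ∈ Submodule.span k (Set.range (word S.basis)) := by
    rw [span_word_eq_top]; exact Submodule.mem_top
  induction hu using Submodule.span_induction with
  | mem u hu => obtain ⟨l, rfl⟩ := hu; exact hword l
  | zero => rw [zero_smul]; exact W.zero_mem
  | add u u' _ _ hu hu' => rw [add_smul]; exact W.add_mem hu hu'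
  | smul c u _ hu => rw [smul_assoc]; exact W.smul_mem c hu

/-! ### The irreducible quotient `L(λ)` -/

/-- **The irreducible highest weight module `L(λ) = M(λ) ⧸ N(λ)`** (Humphreys §20.2–§20.3).
[folklore] -/
def Irr (lam : b.support → k) : Type _ := Verma S lam ⧸ maxSub S lam

/-- Additive structure. [folklore] -/
instance (lam : b.support → k) : AddCommGroup (Irr S lam) :=
  inferInstanceAs (AddCommGroup (Verma S lam ⧸ maxSub S lam))

/-- `U(L)`-module structure. [folklore] -/
instance (lam : b.support → k) : Module 𝓤 (Irr S lam) :=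
  inferInstanceAs (Module 𝓤 (Verma S lam ⧸ maxSub S lam))

/-- `k`-module structure. [folklore] -/
instance (lam : b.support → k) : Module k (Irr S lam) :=
  inferInstanceAs (Module k (Verma S lam ⧸ maxSub S lam))

/-- Compatibility of the two module structures. [folklore] -/
instance (lam : b.support → k) : IsScalarTower k 𝓤 (Irr S lam) :=
  inferInstanceAs (IsScalarTower k 𝓤 (Verma S lam ⧸ maxSub S lam))

/-- The quotient map `M(λ) → L(λ)` (`U(L)`-linear). [folklore] -/
def mkL (lam : b.support → k) : Verma S lam →ₗ[𝓤] Irr S lam := (maxSub S lam).mkQ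

/-- `mkL` is surjective. [folklore] -/
lemma mkL_surjective (lam : b.support → k) : Function.Surjective (mkL S lam) :=
  Submodule.mkQ_surjective _

/-- The kernel of `mkL`. [folklore] -/
lemma mkL_eq_zero_iff (lam : b.support → k) (v : Verma S lam) : mkL S lam v = 0 ↔ v ∈ maxSub S lam :=
  Submodule.Quotient.mk_eq_zero _

/-- `ker mkL = N(λ)`. [folklore] -/
lemma ker_mkL (lam : b.support → k) : LinearMap.ker (mkL S lam) = maxSub S lam := Submodule.ker_mkQ _

/-- `mkL` is `k`-linear. [folklore] -/
lemma mkL_smul (lam : b.support → k) (t : k) (v : Verma S lam) : mkL S lam (t • v) = t • mkL S lam v :=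
  LinearMap.map_smul_of_tower _ t v

/-- `mkL` as a `k`-linear map. [folklore] -/
def mkLk (lam : b.support → k) : Verma S lam →ₗ[k] Irr S lam := (mkL S lam).restrictScalars k

/-- Unfolding of `mkLk`. [folklore] -/
@[simp] lemma mkLk_apply (lam : b.support → k) (v : Verma S lam) : mkLk S lam v = mkL S lam v := rfl

/-- **`L` acts on `L(λ)` through `U(L)`**: `⁅x, v⁆ = ι(x) v`. [folklore] -/
instance instLieRingModuleIrr (lam : b.support → k) : LieRingModule L (Irr S lam) where
  bracket x v := ιU x • v
  add_lie x y v := by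
    change ιU (x + y) • v = ιU x • v + ιU y • v
    rw [map_add, add_smul]
  lie_add x v w := by
    change ιU x • (v + w) = ιU x • v + ιU x • w
    rw [smul_add]
  leibniz_lie x y v := by
    change ιU x • ιU y • v = ιU ⁅x, y⁆ • v + ιU y • ιU x • v
    rw [← mul_smul, ι_mul_ι, add_smul, mul_smul, add_comm]

/-- Unfolding of the bracket. [folklore] -/
lemma lieL_def (lam : b.support → k) (x : L) (v : Irr S lam) : ⁅x, v⁆ = ιU x • v := rfl

/-- **`L(λ)` is a Lie module over `k`.** [folklore] -/
instance instLieModuleIrr (lam : b.support → k) : LieModule k L (Irr S lam) where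
  smul_lie t x v := by
    rw [lieL_def, lieL_def, map_smul, smul_assoc]
  lie_smul t x v := by
    rw [lieL_def, lieL_def, smul_comm]

/-- **`mkL` is a morphism of `L`-modules.** [folklore] -/
@[simp] lemma lie_mkL (lam : b.support → k) (x : L) (v : Verma S lam) :
    ⁅x, mkL S lam v⁆ = mkL S lam ⁅x, v⁆ := by
  rw [lieL_def, lie_def, LinearMap.map_smul]

/-- **The highest weight vector `v̄_λ` of `L(λ)`.** [folklore] -/
def hwvL (lam : b.support → k) : Irr S lam := mkL S lam (hwv S lam)

/-- **`v̄_λ ≠ 0`** (`v_λ ∉ N(λ)`). [folklore] -/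
theorem hwvL_ne_zero (lam : b.support → k) : hwvL S lam ≠ 0 := fun h0 =>
  hwv_notMem_maxSub S lam ((mkL_eq_zero_iff S lam _).1 h0)

/-- `L(λ)` is generated by `v̄_λ`. [folklore] -/
theorem exists_smul_hwvL_eq (lam : b.support → k) (v : Irr S lam) : ∃ u : 𝓤, u • hwvL S lam = v := by
  obtain ⟨w, rfl⟩ := mkL_surjective S lam v
  obtain ⟨u, rfl⟩ := exists_smul_hwv_eq S lam w
  exact ⟨u, by rw [hwvL, ← LinearMap.map_smul]⟩

/-- `e_β v̄_λ = 0` for `β > 0`. [folklore] -/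
theorem lie_e_hwvL_of_isPos (lam : b.support → k) {i : ι} (hi : b.IsPos i) : ⁅e i, hwvL S lam⁆ = 0 := by
  rw [hwvL, lie_mkL, lie_e_hwv_of_isPos S lam hi, map_zero]

/-- `h_s v̄_λ = λ_s v̄_λ`. [folklore] -/
theorem lie_h_hwvL (lam : b.support → k) (s : b.support) : ⁅h s, hwvL S lam⁆ = lam s • hwvL S lam := by
  rw [hwvL, lie_mkL, lie_h_hwv S lam s, mkL_smul]

/-- **`L(λ)` is irreducible**: every `U(L)`-submodule is `⊥` or `⊤` (pull back to `M(λ)` and use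
the maximality of `N(λ)`, `eq_top_or_le_maxSub`). [folklore] -/
theorem eq_bot_or_eq_top [CharZero k] [Module.Finite ℤ X] [P.IsReduced] (lam : b.support → k)
    (W : Submodule 𝓤 (Irr S lam)) : W = ⊥ ∨ W = ⊤ := by
  rcases eq_top_or_le_maxSub S lam (W.comap (mkL S lam)) with htop | hle
  · right
    rw [← Submodule.map_comap_eq_of_surjective (f := mkL S lam) (mkL_surjective S lam) W, htop,
      Submodule.map_top]
    exact LinearMap.range_eq_top.2 (mkL_surjective S lam)
  · left
    rw [← Submodule.map_comap_eq_of_surjective (f := mkL S lam) (mkL_surjective S lam) W, eq_bot_iff]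
    rintro _ ⟨v, hv, rfl⟩
    rw [Submodule.mem_bot, mkL_eq_zero_iff]
    exact hle hv

/-- **Irreducibility for `k`-subspaces**: a `k`-subspace of `L(λ)` stable under the action of `L`
is `⊥` or `⊤`. [folklore] -/
theorem eq_bot_or_eq_top_of_forall_lie_mem [CharZero k] [Module.Finite ℤ X] [P.IsReduced]
    (lam : b.support → k) (W : Submodule k (Irr S lam)) (hW : ∀ (x : L), ∀ v ∈ W, ⁅x, v⁆ ∈ W) :
    W = ⊥ ∨ W = ⊤ := by
  let W' : Submodule 𝓤 (Irr S lam) :=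
    { carrier := W
      zero_mem' := W.zero_mem
      add_mem' := W.add_mem
      smul_mem' := fun u v hv => smul_mem_of_forall_ι_smul_mem S W hW u hv }
  rcases eq_bot_or_eq_top S lam W' with h0 | h1
  · left
    rw [eq_bot_iff]
    intro v hv
    have : v ∈ W' := hv
    rw [h0] at this
    exact this
  · right
    rw [eq_top_iff]
    intro v _
    have : v ∈ W' := by rw [h1]; exact Submodule.mem_top
    exact this

/-! ### Weight spaces of `L(λ)` -/

/-- The `X`-degree-`x` weight space `L(λ)_x` (image of `M(λ)_x`; the weight space of weight
`λ + x`). [folklore] -/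
def wspL (lam : b.support → k) (x : X) : Submodule k (Irr S lam) := (wsp S lam x).map (mkLk S lam)

/-- `mkL` maps `M(λ)_x` into `L(λ)_x`. [folklore] -/
lemma mkL_mem_wspL (lam : b.support → k) {x : X} {v : Verma S lam} (hv : v ∈ wsp S lam x) :
    mkL S lam v ∈ wspL S lam x := ⟨v, hv, rfl⟩

/-- `v̄_λ ∈ L(λ)_0`. [folklore] -/
lemma hwvL_mem_wspL (lam : b.support → k) : hwvL S lam ∈ wspL S lam 0 :=
  mkL_mem_wspL S lam (hwv_mem_wsp S lam)

/-- **`h_s` acts on `L(λ)_x` by `λ_s + ⟨x, α_s^∨⟩`.** [folklore] -/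
theorem lie_h_of_mem_wspL (lam : b.support → k) {x : X} {v : Irr S lam} (hv : v ∈ wspL S lam x)
    (s : b.support) : ⁅h s, v⁆ = (lam s + xChar b k x s) • v := by
  obtain ⟨w, hw, rfl⟩ := hv
  rw [mkLk_apply, lie_mkL, lie_h_of_mem_wsp S lam hw s, mkL_smul]

/-- **`e_α L(λ)_x ⊆ L(λ)_{x+α}`.** [folklore] -/
theorem lie_e_mem_wspL [CharZero k] [Module.Finite ℤ X] (lam : b.support → k) {x : X}
    (hx : x ∈ P.rootSpan ℤ) {v : Irr S lam} (hv : v ∈ wspL S lam x) (i : ι) :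
    ⁅e i, v⁆ ∈ wspL S lam (x + P.root i) := by
  obtain ⟨w, hw, rfl⟩ := hv
  rw [mkLk_apply, lie_mkL]
  exact mkL_mem_wspL S lam (lie_e_mem_wsp S lam hx hw i)

/-- A basis vector of `L` maps `L(λ)_x` into some `L(λ)_y`, `y` in the root lattice. [folklore] -/
theorem lie_basis_mem_wspL [CharZero k] [Module.Finite ℤ X] (lam : b.support → k) {x : X}
    (hx : x ∈ P.rootSpan ℤ) {v : Irr S lam} (hv : v ∈ wspL S lam x) (j : b.support ⊕ ι) :
    ∃ y ∈ P.rootSpan ℤ, ⁅S.basis j, v⁆ ∈ wspL S lam y := by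
  rcases j with s | i
  · refine ⟨x, hx, ?_⟩
    rw [IsChevalleySystem.coe_basis, Sum.elim_inl, lie_h_of_mem_wspL S lam hv s]
    exact Submodule.smul_mem _ _ hv
  · refine ⟨x + P.root i, Submodule.add_mem _ hx (Submodule.subset_span (mem_range_self i)), ?_⟩
    rw [IsChevalleySystem.coe_basis, Sum.elim_inr]
    exact lie_e_mem_wspL S lam hx hv i

/-- The weight spaces of degrees outside the root lattice vanish. [folklore] -/
theorem wspL_eq_bot_of_notMem (lam : b.support → k) {x : X} (hx : x ∉ P.rootSpan ℤ) :
    wspL S lam x = ⊥ := by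
  rw [wspL, wsp, Submodule.map_span, Submodule.span_eq_bot]
  rintro _ ⟨_, ⟨n, hn, rfl⟩, rfl⟩
  exact absurd (hn ▸ rootSum_mem_rootSpan n) hx

/-- **The weight spaces span `L(λ)`.** [folklore] -/
theorem iSup_wspL_eq_top (lam : b.support → k) : ⨆ x : X, wspL S lam x = ⊤ := by
  rw [eq_top_iff]
  intro v _
  obtain ⟨w, rfl⟩ := mkL_surjective S lam v
  have hw : w ∈ ⨆ x : X, wsp S lam x := by
    have htop : Submodule.span k (Set.range (vermaBasis S lam)) = ⊤ := (vermaBasis S lam).span_eq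
    have : w ∈ Submodule.span k (Set.range (vermaBasis S lam)) := by rw [htop]; exact Submodule.mem_top
    refine Submodule.span_le.2 ?_ this
    rintro _ ⟨n, rfl⟩
    exact Submodule.mem_iSup_of_mem (rootSum b n) (Submodule.subset_span ⟨n, rfl, rfl⟩)
  rw [← mkLk_apply, ← Submodule.mem_comap]
  have hle : ⨆ x : X, wsp S lam x ≤ (⨆ x : X, wspL S lam x).comap (mkLk S lam) := by
    refine iSup_le fun x => ?_
    rw [← Submodule.map_le_iff_le_comap]
    exact le_iSup (fun x => wspL S lam x) x
  exact hle hw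

/-- **The weight spaces of `L(λ)` are finite-dimensional** (finitely many multi-indices of each
degree, `finite_rootSum_eq`). [folklore] -/
instance finiteDimensional_wspL [P.IsReduced] (lam : b.support → k) (x : X) :
    FiniteDimensional k (wspL S lam x) := by
  have : FiniteDimensional k (wsp S lam x) :=
    FiniteDimensional.span_of_finite k ((finite_rootSum_eq (b := b) x).image _)
  exact Module.Finite.map _ _

/-- **The weight spaces of `L(λ)` are independent**: a finite sum `∑ v_x = 0` of weight vectors
of distinct degrees has all `v_x = 0` (the characters of distinct degrees in the root lattice
differ, `eq_of_xChar_eq`; `DiagSep.eq_zero_of_sum_eigen_eq_zero`). [folklore] -/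
theorem eq_zero_of_sum_wspL_eq_zero [CharZero k] [Module.Finite ℤ X] (lam : b.support → k)
    (F : Finset X) (v : X → Irr S lam) (hv : ∀ x ∈ F, v x ∈ wspL S lam x)
    (h0 : ∑ x ∈ F, v x = 0) : ∀ x ∈ F, v x = 0 := by
  classical
  -- discard the degrees outside the root lattice (their weight spaces vanish)
  set F' := F.filter fun x => x ∈ P.rootSpan ℤ with hF'
  have hout : ∀ x ∈ F, x ∉ P.rootSpan ℤ → v x = 0 := fun x hx hxn => by
    have := hv x hx
    rw [wspL_eq_bot_of_notMem S lam hxn, Submodule.mem_bot] at this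
    exact this
  have h0' : ∑ x ∈ F', v x = 0 := by
    rw [hF', Finset.sum_filter_of_ne fun x hx hne => by_contra fun hxn => hne (hout x hx hxn)]
    exact h0
  have key := DiagSep.eq_zero_of_sum_eigen_eq_zero
    (fun s : b.support => LieModule.toEnd k L (Irr S lam) (h s)) F'
    (fun x s => lam s + xChar b k x s) v
    (fun x hx s => by
      rw [LieModule.toEnd_apply_apply]
      exact lie_h_of_mem_wspL S lam (hv x (Finset.mem_filter.1 hx).1) s)
    (fun x hx y hy hne => by
      by_contra hall
      push Not at hall
      refine hne (eq_of_xChar_eq (k := k) (b := b) (Submodule.sub_mem _ (Finset.mem_filter.1 hx).2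
        (Finset.mem_filter.1 hy).2) (funext fun s => add_left_cancel (hall s))))
    h0'
  intro x hx
  by_cases hxr : x ∈ P.rootSpan ℤ
  · exact key x (Finset.mem_filter.2 ⟨hx, hxr⟩)
  · exact hout x hx hxr

/-- **Independence of the weight spaces** as `iSupIndep`. [folklore] -/
theorem iSupIndep_wspL [CharZero k] [Module.Finite ℤ X] (lam : b.support → k) :
    iSupIndep fun x : X => wspL S lam x := by
  classical
  rw [iSupIndep_def]
  intro x
  rw [Submodule.disjoint_def]
  intro v hv hv'
  obtain ⟨f, hf, hsum⟩ := (Submodule.mem_iSup_iff_exists_finsupp _ _).1 hv'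
  have hfx : f x = 0 := by
    have := hf x
    rwa [iSup_neg (not_not.2 rfl), Submodule.mem_bot] at this
  have hfj : ∀ j, j ≠ x → f j ∈ wspL S lam j := fun j hj => by
    have := hf j
    rwa [iSup_pos hj] at this
  -- the relation `∑_{j} (f j - δ_{j x} v) = 0` over `insert x f.support`
  have hrel : ∑ j ∈ insert x f.support, (f j - Finsupp.single x v j) = 0 := by
    rw [Finset.sum_sub_distrib,
      Finset.sum_insert_of_eq_zero_if_notMem (fun h => Finsupp.notMem_support_iff.1 h),
      Finset.sum_eq_single x (fun j _ hj => Finsupp.single_eq_of_ne hj)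
        (fun hx => absurd (Finset.mem_insert_self _ _) hx), Finsupp.single_eq_same]
    change (f.sum fun _ xi => xi) - v = 0
    rw [hsum, sub_self]
  have key := eq_zero_of_sum_wspL_eq_zero S lam (insert x f.support)
    (fun j => f j - Finsupp.single x v j) (fun j _ => by
      by_cases hj : j = x
      · subst hj
        rw [Finsupp.single_eq_same, hfx, zero_sub]
        exact Submodule.neg_mem _ hv
      · rw [Finsupp.single_eq_of_ne hj, sub_zero]
        exact hfj j hj) hrel x (Finset.mem_insert_self _ _)
  rw [Finsupp.single_eq_same, hfx, zero_sub, neg_eq_zero] at key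
  exact key

end System

end ChevalleyVerma

end Literature.NumberTheory.Automorphic
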